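import Literature.NumberTheory.Automorphic.InvariantMeasureDomination
import Literature.NumberTheory.Automorphic.AdelicSecondCountable
import Literature.NumberTheory.Automorphic.CompactSubgroupAveraging
import Literature.NumberTheory.Automorphic.UnramifiedHeckeScalarsFlathProofs
import Literature.NumberTheory.Automorphic.AutomorphicSpectrumProofs
import Literature.NumberTheory.Automorphic.GLnAdelicStructureProofs
import Literature.NumberTheory.Automorphic.AutomorphicLFunction
import HarnessLib

/-!
# Smoothed `L²`-automorphic forms: continuous representatives, level, Hecke eigenvalues

Trunk `AutomorphicAxiomatic` (G19), topic `NumberTheory/Automorphic`; namespace `Literature.Automorphic`.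
Brick (S) of the Jacquet–Shalika programme of `InvariantMeasureDomination` (towards
`StandardLFunctionData.multipliable_L` for `GL_2` without Rankin–Selberg theory): the vectors of a
cuspidal automorphic representation `Π ⊆ L²(GL_n(𝔸_K) ⧸ A_G GL_n(K), μ)` are `L²`-classes; the
mean-square method needs an honest *continuous* function on `GL_n(𝔸_K)` with the same level and
Hecke eigenvalues. Smoothing by a weight `η ∈ C_c(GL_n(𝔸_K))` does it:

* `adelicBorel`, `adelicHaar` — the Borel structure (a *local* instance, as in
  `AutomorphicSpectrumProofs`) and a Haar measure on `GL_n(𝔸_K)` (locally compact: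
  `locallyCompactSpace_gl_adelic_holds`; second countable: `AdelicSecondCountable`);
  `basePoint` with open/continuous/surjective orbit map.
* `smoothedForm η f (x) = ∫ η(g) f(g⁻¹ • x) dg` (`orbitalSmoothing`) — **continuous** for
  `f ∈ L²` (`continuous_smoothedForm`, by `continuous_orbitalSmoothing` and the axioms of
  `IsAutomorphicMeasure` only) and `Kf`-invariant for left-`Kf`-invariant `η` (`smoothedForm_smul`).
* `smoothedVector W η f = ∫ η(g) • (g · f) dg ∈ W` for a closed subrepresentation `W` (Bochner
  integral in the complete subspace `W`); `coe_smoothedVector` (it is the Bochner integral of the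
  translates in `L²`), `smoothedVector_ae_eq` (**represented by `smoothedForm`**,
  `coeFn_integral_smul_domSMul_ae_eq`), `smoothedVector_mem_fixedVectors`;
  `exists_weight_smoothedVector_ne_zero` — **non-zero smoothings exist** for every non-zero
  `Kf`-fixed `f` and compact `Kf` (weight from `CompactSubgroupAveraging` supported where
  `Re ⟪f, R(g) f⟫ > ‖f‖²/2`).
* `heckeOperatorAt_eq_satake_smul` — at a fixed level `K(𝔫₀)` every `K(𝔫₀)`-fixed vector of a
  cuspidal `Π` with Satake family `α` off `S` is an eigenvector of `T_{v,i}`, `v ∉ S`, `v ∤ 𝔫₀`,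
  with the Satake eigenvalues `q_v^{i(n-i)/2} e_i(α v)`
  (`Flath1979_heckeOperatorAt_ofLocal_eq_smul_holds` + level independence
  `heckeOperatorAt_ofLocal_apply_eq_of_le`);
* `sum_smoothedForm_inv_smul_eq` — the eigen-equation **pointwise** for the continuous smoothed
  form: `Σ_{y ∈ s} S_η f (y⁻¹ • x) = c · S_η f (x)` for every transversal `s` of `Kf t Kf / Kf` and
  every `x` (a.e. from `heckeOperator_apply_eq_sum` and `rightRegular_apply_coeFn`, everywhere by
  continuity and `IsOpenPosMeasure`).

Pointwise cuspidality of the smoothed form (vanishing constant terms) is left to a sequel (it needs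
an explicit additive fundamental domain of `K` in `𝔸_K`). All statements are proved; folklore
(Borel–Jacquet, Corvallis (1979), §4.4–4.6; Gelbart, *Automorphic forms on adele groups*, §3).
-/

noncomputable section

open MeasureTheory Measure Set Filter Topology IsDedekindDomain NumberField

namespace Literature.NumberTheory.Automorphic

section Setup

variable (n : ℕ) (K : Type) [Field K] [NumberField K]

/-- The Borel σ-algebra on `GL_n(𝔸_K)` (a *local* instance below; the tree equips `𝒢.Adelic` with
`borel` only locally, cf. `AutomorphicSpectrumProofs`). [folklore] -/
@[reducible] def adelicBorel : MeasurableSpace (AdelicGroupData.gl n K).Adelic := borel _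

attribute [local instance] adelicBorel

/-- `GL_n(𝔸_K)` with `adelicBorel` is a Borel space (by definition). [folklore] -/
theorem borelSpace_adelic : BorelSpace (AdelicGroupData.gl n K).Adelic := ⟨rfl⟩

attribute [local instance] borelSpace_adelic

/-- `GL_n(𝔸_K)` is locally compact (`locallyCompactSpace_gl_adelic_holds`). [folklore] -/
theorem locallyCompactSpace_adelic : LocallyCompactSpace (AdelicGroupData.gl n K).Adelic :=
  AdelicGroupData.locallyCompactSpace_gl_adelic_holds n K

attribute [local instance] locallyCompactSpace_adelic

attribute [local instance] secondCountableTopology_gl_adelic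

/-- A left Haar measure on `GL_n(𝔸_K)`. [folklore] -/
def adelicHaar : Measure (AdelicGroupData.gl n K).Adelic := Measure.haar

/-- `adelicHaar` is a Haar measure (instance on a term of this file). [folklore] -/
instance : (adelicHaar n K).IsHaarMeasure := by unfold adelicHaar; infer_instance

/-- The base point `x₀ = 1 · (A_G GL_n(K))` of the automorphic quotient. [folklore] -/
def basePoint : (AdelicGroupData.gl n K).automorphicQuotient :=
  (AdelicGroupData.gl n K).toAutomorphicQuotient 1

/-- The orbit map of the base point is open. [folklore] -/
theorem isOpenMap_smul_basePoint :
    IsOpenMap fun g : (AdelicGroupData.gl n K).Adelic => g • basePoint n K :=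
  isOpenMap_smul_quotient _ _

/-- The orbit map of the base point is continuous. [folklore] -/
theorem continuous_smul_basePoint :
    Continuous fun g : (AdelicGroupData.gl n K).Adelic => g • basePoint n K :=
  continuous_smul_quotient _ _

/-- The orbit map of the base point is surjective. [folklore] -/
theorem surjective_smul_basePoint :
    Function.Surjective fun g : (AdelicGroupData.gl n K).Adelic => g • basePoint n K :=
  surjective_smul_quotient _ _

/-- `g • x₀` is the class of `g`. [folklore] -/
theorem smul_basePoint (g : (AdelicGroupData.gl n K).Adelic) :
    g • basePoint n K = (AdelicGroupData.gl n K).toAutomorphicQuotient g := by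
  change (AdelicGroupData.gl n K).toAutomorphicQuotient (g * 1) = _
  rw [mul_one]

end Setup

section Smooth

variable {n : ℕ} {K : Type} [Field K] [NumberField K]
  {μ : Measure (AdelicGroupData.gl n K).automorphicQuotient}
  [(AdelicGroupData.gl n K).IsAutomorphicMeasure μ]

attribute [local instance] adelicBorel borelSpace_adelic locallyCompactSpace_adelic
  secondCountableTopology_gl_adelic

/-- The **smoothing** `S_η f (x) = ∫ η(g) f(g⁻¹ • x) dg` of an `L²` automorphic form `f` by a weight
`η` on `GL_n(𝔸_K)` (Haar measure `adelicHaar`; `InvariantMeasureDomination.orbitalSmoothing`).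
[folklore] -/
def smoothedForm (η : (AdelicGroupData.gl n K).Adelic → ℝ) (f : (AdelicGroupData.gl n K).L2 μ) :
    (AdelicGroupData.gl n K).automorphicQuotient → ℂ :=
  orbitalSmoothing (adelicHaar n K) (fun g => (η g : ℂ))
    (f : (AdelicGroupData.gl n K).automorphicQuotient → ℂ)

variable (μ) in
/-- An `L²` automorphic form is integrable (the automorphic measure is finite). [folklore] -/
theorem integrable_coeFn_L2 (f : (AdelicGroupData.gl n K).L2 μ) :
    Integrable (f : (AdelicGroupData.gl n K).automorphicQuotient → ℂ) μ :=
  (Lp.memLp f).integrable one_le_two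

/-- **The smoothing of an `L²` automorphic form by a continuous compactly supported weight is
continuous.** [folklore] -/
theorem continuous_smoothedForm {η : (AdelicGroupData.gl n K).Adelic → ℝ} (hη : Continuous η)
    (hηs : HasCompactSupport η) (f : (AdelicGroupData.gl n K).L2 μ) :
    Continuous (smoothedForm η f) := by
  have hηc : Continuous fun g => (η g : ℂ) := Complex.continuous_ofReal.comp hη
  have hηsc : HasCompactSupport fun g => (η g : ℂ) := hηs.comp_left Complex.ofReal_zero
  exact continuous_orbitalSmoothing μ (adelicHaar n K) (isOpenMap_smul_basePoint n K)
    (surjective_smul_basePoint n K) (continuous_smul_basePoint n K) hηc hηsc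
    (integrable_coeFn_L2 μ f)

omit [(AdelicGroupData.gl n K).IsAutomorphicMeasure μ] in
/-- The smoothing by a left `Kf`-invariant weight is `Kf`-invariant: `S_η f (k • x) = S_η f (x)`.
[folklore] -/
theorem smoothedForm_smul {η : (AdelicGroupData.gl n K).Adelic → ℝ}
    {Kf : Subgroup (AdelicGroupData.gl n K).Adelic} (hηK : ∀ k ∈ Kf, ∀ g, η (k * g) = η g)
    (f : (AdelicGroupData.gl n K).L2 μ) {k : (AdelicGroupData.gl n K).Adelic} (hk : k ∈ Kf)
    (x : (AdelicGroupData.gl n K).automorphicQuotient) :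
    smoothedForm η f (k • x) = smoothedForm η f x := by
  unfold smoothedForm orbitalSmoothing
  rw [← integral_mul_left_eq_self (μ := adelicHaar n K) _ k]
  congr 1 with g
  simp only []
  rw [hηK k hk g, mul_inv_rev, smul_smul, inv_mul_cancel_right]

/-! ### The smoothed vector inside a closed subrepresentation -/

variable (W : ContRepresentation.ClosedSubrep ((AdelicGroupData.gl n K).rightRegular μ))

/-- A closed subrepresentation of `L²` is complete (instance on a term of this file). [folklore] -/
instance completeSpace_closedSubrep : CompleteSpace W.toSubmodule :=
  W.isClosed.completeSpace_coe

/-- Strong continuity of the restricted representation on a closed subrepresentation of `L²`.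
[folklore] -/
theorem continuous_toContRep_apply (f : W.toSubmodule) :
    Continuous fun g : (AdelicGroupData.gl n K).Adelic => W.toContRep g f := by
  refine continuous_induced_rng.2 ?_
  change Continuous fun g : (AdelicGroupData.gl n K).Adelic =>
    ((AdelicGroupData.gl n K).rightRegular μ g (f : (AdelicGroupData.gl n K).L2 μ))
  exact (AdelicGroupData.isStronglyContinuous_rightRegular_holds (AdelicGroupData.gl n K) μ) _

/-- The **smoothed vector** `∫ η(g) • (g · f) dg ∈ W` of `f ∈ W` (Bochner integral in the closed,
hence complete, subspace `W ≤ L²`). [folklore] -/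
def smoothedVector (η : (AdelicGroupData.gl n K).Adelic → ℝ) (f : W.toSubmodule) : W.toSubmodule :=
  ∫ g, (η g : ℂ) • W.toContRep g f ∂(adelicHaar n K)

/-- The integrand `η(g) • (g · f)` of the smoothed vector is Bochner integrable. [folklore] -/
theorem integrable_smul_toContRep {η : (AdelicGroupData.gl n K).Adelic → ℝ} (hη : Continuous η)
    (hηs : HasCompactSupport η) (f : W.toSubmodule) :
    Integrable (fun g => (η g : ℂ) • W.toContRep g f) (adelicHaar n K) := by
  refine Continuous.integrable_of_hasCompactSupport ?_ ?_
  · exact (Complex.continuous_ofReal.comp hη).smul (continuous_toContRep_apply W f)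
  · exact (hηs.comp_left Complex.ofReal_zero).smul_right

/-- In `L²`, the smoothed vector is the Bochner integral of the translates `η(g) • R(g) f`.
[folklore] -/
theorem coe_smoothedVector {η : (AdelicGroupData.gl n K).Adelic → ℝ} (hη : Continuous η)
    (hηs : HasCompactSupport η) (f : W.toSubmodule) :
    (smoothedVector W η f : (AdelicGroupData.gl n K).L2 μ) =
      ∫ g, (η g : ℂ) • (AdelicGroupData.gl n K).rightRegular μ g
        (f : (AdelicGroupData.gl n K).L2 μ) ∂(adelicHaar n K) := by
  unfold smoothedVector
  rw [← Submodule.subtypeL_apply,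
    ← ContinuousLinearMap.integral_comp_comm _ (integrable_smul_toContRep W hη hηs f)]
  rfl

/-- **The smoothed vector is represented by the (continuous) smoothed form.** [folklore] -/
theorem smoothedVector_ae_eq {η : (AdelicGroupData.gl n K).Adelic → ℝ} (hη : Continuous η)
    (hηs : HasCompactSupport η) (f : W.toSubmodule) :
    ((smoothedVector W η f : (AdelicGroupData.gl n K).L2 μ) :
        (AdelicGroupData.gl n K).automorphicQuotient → ℂ) =ᵐ[μ]
      smoothedForm η (f : (AdelicGroupData.gl n K).L2 μ) := by
  rw [coe_smoothedVector W hη hηs f]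
  simp only [AdelicGroupData.rightRegular_apply]
  have hF : AEStronglyMeasurable (fun g : (AdelicGroupData.gl n K).Adelic =>
      (DomMulAct.mk g⁻¹ • (f : (AdelicGroupData.gl n K).L2 μ) : (AdelicGroupData.gl n K).L2 μ))
      (adelicHaar n K) := by
    have := (AdelicGroupData.isStronglyContinuous_rightRegular_holds (AdelicGroupData.gl n K) μ)
      (f : (AdelicGroupData.gl n K).L2 μ)
    simp only [AdelicGroupData.rightRegular_apply] at this
    exact this.aestronglyMeasurable
  exact coeFn_integral_smul_domSMul_ae_eq μ (adelicHaar n K) (Complex.continuous_ofReal.comp hη)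
    (hηs.comp_left Complex.ofReal_zero) _ hF

/-- The smoothed vector by a left `Kf`-invariant weight is `Kf`-fixed. [folklore] -/
theorem smoothedVector_mem_fixedVectors {η : (AdelicGroupData.gl n K).Adelic → ℝ}
    (hη : Continuous η) (hηs : HasCompactSupport η)
    {Kf : Subgroup (AdelicGroupData.gl n K).Adelic} (hηK : ∀ k ∈ Kf, ∀ g, η (k * g) = η g)
    (f : W.toSubmodule) : smoothedVector W η f ∈ W.fixedVectors Kf := by
  rw [ContRepresentation.ClosedSubrep.mem_fixedVectors]
  intro k hk
  unfold smoothedVector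
  rw [← ContinuousLinearMap.integral_comp_comm _ (integrable_smul_toContRep W hη hηs f)]
  change ∫ g, W.toContRep k ((η g : ℂ) • W.toContRep g f) ∂(adelicHaar n K) = _
  have h1 : (fun g => W.toContRep k ((η g : ℂ) • W.toContRep g f)) =
      fun g => (fun g' => (η (k⁻¹ * g') : ℂ) • W.toContRep g' f) (k * g) := by
    funext g
    simp only [map_smul, inv_mul_cancel_left]
    rw [map_mul]
    rfl
  rw [h1, integral_mul_left_eq_self (μ := adelicHaar n K)
    (fun g' => (η (k⁻¹ * g') : ℂ) • W.toContRep g' f) k]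
  congr 1 with g
  rw [hηK k⁻¹ (Kf.inv_mem hk) g]

/-- **Non-vanishing smoothings exist.** For a compact level subgroup `Kf` and a non-zero `Kf`-fixed
`f ∈ W`, some continuous compactly supported weight `η ≥ 0`, left `Kf`-invariant, gives a non-zero
smoothed vector (take `η` supported where `Re ⟪f, R(g) f⟫ > ‖f‖²/2`, an open neighbourhood of
`Kf` by strong continuity; then `Re ⟪f, ∫ η(g) R(g) f⟫ ≥ (‖f‖²/2) ∫ η > 0`). [folklore] -/
theorem exists_weight_smoothedVector_ne_zero {Kf : Subgroup (AdelicGroupData.gl n K).Adelic}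
    (hKc : IsCompact (Kf : Set (AdelicGroupData.gl n K).Adelic)) {f : W.toSubmodule}
    (hf : f ∈ W.fixedVectors Kf) (hf0 : f ≠ 0) :
    ∃ η : (AdelicGroupData.gl n K).Adelic → ℝ, Continuous η ∧ HasCompactSupport η ∧ 0 ≤ η ∧
      (∀ k ∈ Kf, ∀ g, η (k * g) = η g) ∧ smoothedVector W η f ≠ 0 := by
  set F := ((f : W.toSubmodule) : (AdelicGroupData.gl n K).L2 μ) with hF
  have hF0 : F ≠ 0 := fun h => hf0 (Subtype.ext h)
  have hnorm : 0 < ‖F‖ ^ 2 / 2 := by positivity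
  -- the open neighbourhood of `Kf`
  set U : Set (AdelicGroupData.gl n K).Adelic :=
    {g | ‖F‖ ^ 2 / 2 < RCLike.re (inner ℂ F ((AdelicGroupData.gl n K).rightRegular μ g F))} with hU
  have hcont : Continuous fun g =>
      RCLike.re (inner ℂ F ((AdelicGroupData.gl n K).rightRegular μ g F)) :=
    RCLike.continuous_re.comp (continuous_const.inner
      ((AdelicGroupData.isStronglyContinuous_rightRegular_holds (AdelicGroupData.gl n K) μ) F))
  have hUo : IsOpen U := isOpen_lt continuous_const hcont
  have hKU : (Kf : Set (AdelicGroupData.gl n K).Adelic) ⊆ U := by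
    intro k hk
    have hfix : (AdelicGroupData.gl n K).rightRegular μ k F = F := by
      have h1 := (ContRepresentation.ClosedSubrep.mem_fixedVectors W Kf f).1 hf k hk
      have h2 := congrArg (fun v : W.toSubmodule => (v : (AdelicGroupData.gl n K).L2 μ)) h1
      simp only [ContRepresentation.ClosedSubrep.coe_toContRep_apply] at h2
      exact h2
    change ‖F‖ ^ 2 / 2 < RCLike.re (inner ℂ F ((AdelicGroupData.gl n K).rightRegular μ k F))
    rw [hfix, inner_self_eq_norm_sq_to_K]
    norm_cast
    linarith [sq_nonneg ‖F‖]
  obtain ⟨η, hη, hηs, hη0, hηK, hη1, hsupp⟩ :=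
    exists_continuous_invariant_nonneg_pos Kf hKc hUo hKU
  refine ⟨η, hη, hηs, hη0, hηK, fun hzero => ?_⟩
  -- `Re ⟪F, smoothed⟫ = ∫ η · Re ⟪F, R g F⟫ ≥ (‖F‖²/2) ∫ η > 0`
  have hint : Integrable (fun g => (η g : ℂ) • (AdelicGroupData.gl n K).rightRegular μ g F)
      (adelicHaar n K) :=
    ((Complex.continuous_ofReal.comp hη).smul
      ((AdelicGroupData.isStronglyContinuous_rightRegular_holds (AdelicGroupData.gl n K) μ) F))
      |>.integrable_of_hasCompactSupport ((hηs.comp_left Complex.ofReal_zero).smul_right)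
  have hre : RCLike.re (inner ℂ F (smoothedVector W η f : (AdelicGroupData.gl n K).L2 μ)) =
      ∫ g, η g * RCLike.re (inner ℂ F ((AdelicGroupData.gl n K).rightRegular μ g F))
        ∂(adelicHaar n K) := by
    rw [coe_smoothedVector W hη hηs f, ← hF, ← integral_inner hint]
    have : (fun g => inner ℂ F ((η g : ℂ) • (AdelicGroupData.gl n K).rightRegular μ g F)) =
        fun g => ((η g : ℂ) * inner ℂ F ((AdelicGroupData.gl n K).rightRegular μ g F)) := by
      funext g; rw [inner_smul_right]
    rw [this, ← integral_re (hint.const_inner F |>.congr (Eventually.of_forall fun g => by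
      simp only [inner_smul_right]))]
    congr 1 with g
    -- `re ((η g : ℂ) * z) = η g * re z`
    exact RCLike.re_ofReal_mul (K := ℂ) (η g) _
  -- pointwise lower bound on the integrand, from `support η ⊆ U` and `η ≥ 0`
  have hlow : ∀ g, η g * (‖F‖ ^ 2 / 2) ≤
      η g * RCLike.re (inner ℂ F ((AdelicGroupData.gl n K).rightRegular μ g F)) := by
    intro g
    by_cases hg : η g = 0
    · rw [hg, zero_mul, zero_mul]
    · exact mul_le_mul_of_nonneg_left (le_of_lt (hsupp (Function.mem_support.2 hg))) (hη0 g)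
  have hi1 : Integrable (fun g => η g * (‖F‖ ^ 2 / 2)) (adelicHaar n K) :=
    (hη.integrable_of_hasCompactSupport hηs).mul_const _
  have hi2 : Integrable (fun g => η g * RCLike.re (inner ℂ F
      ((AdelicGroupData.gl n K).rightRegular μ g F))) (adelicHaar n K) :=
    (hη.mul hcont).integrable_of_hasCompactSupport hηs.mul_right
  have hpos : 0 < ∫ g, η g * (‖F‖ ^ 2 / 2) ∂(adelicHaar n K) := by
    rw [integral_mul_const]
    exact mul_pos (hη.integral_pos_of_hasCompactSupport_nonneg_nonzero hηs hη0 hη1.ne') hnorm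
  have hge := integral_mono hi1 hi2 hlow
  have hzero' :
      RCLike.re (inner ℂ F (smoothedVector W η f : (AdelicGroupData.gl n K).L2 μ)) = 0 := by
    rw [hzero]; simp
  linarith [hre ▸ hzero']

end Smooth

/-! ### Hecke eigenvalues of smoothed vectors of cuspidal representations -/

section Hecke

variable {n : ℕ} {K : Type} [Field K] [NumberField K]
  {μ : Measure (AdelicGroupData.gl n K).automorphicQuotient}
  [(AdelicGroupData.gl n K).IsAutomorphicMeasure μ]

attribute [local instance] adelicBorel borelSpace_adelic locallyCompactSpace_adelic
  secondCountableTopology_gl_adelic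

/-- **Satake eigenvalues at one fixed level.** Let `Π` be cuspidal with Satake family `α` off `S`
(`IsSatakeFamilyOf`), and `F ∈ Π^{K(𝔫₀)}` any `K(𝔫₀)`-fixed vector, `𝔫₀ ≠ 0`. Then at every
`v ∉ S` with `v ∤ 𝔫₀` there is a uniformizer `ϖ_v` (the one of the Satake datum) such that
`T_{v,i} F = q_v^{i(n-i)/2} e_i(α v) • F` for `[K(𝔫₀) t_{v,i} K(𝔫₀)]`, `0 ≤ i ≤ n`: the unramified
Hecke algebra acts by scalars on `Π^{K(𝔫₀𝔫_v)}` (`Flath1979_heckeOperatorAt_ofLocal_eq_smul_holds`)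
and the operators at levels `K(𝔫₀)`, `K(𝔫_v)`, `K(𝔫₀𝔫_v)` agree on the common fixed vectors
(`heckeOperatorAt_ofLocal_apply_eq_of_le`). [folklore] -/
theorem heckeOperatorAt_eq_satake_smul (P : CuspidalAutomorphicRepGL n K μ)
    {S : Set (HeightOneSpectrum (𝓞 K))} {α : SatakeFamily K} (hα : IsSatakeFamilyOf P S α)
    {𝔫₀ : Ideal (𝓞 K)} (h𝔫₀ : 𝔫₀ ≠ 0) {v : HeightOneSpectrum (𝓞 K)} (hvS : v ∉ S)
    (hv : ¬ v.asIdeal ∣ 𝔫₀) {F : P.1.toSubmodule}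
    (hF : F ∈ P.1.fixedVectors (principalCongruenceLevel n K 𝔫₀)) :
    ∃ ϖ : (v.adicCompletion K)ˣ, Valued.v (ϖ : v.adicCompletion K) = WithZero.exp (-1 : ℤ) ∧
      ∀ i ≤ n, heckeOperatorAt P.1 (principalCongruenceLevel n K 𝔫₀) (heckeDiagAt n K v ϖ i) F =
        ((((Real.sqrt (v.residueCard : ℝ) : ℝ) : ℂ) ^ (i * (n - i)) * (α v).esymm i)) • F := by
  obtain ⟨𝔫, h𝔫, hv𝔫, ϖ, hsat⟩ := hα v hvS
  obtain ⟨hϖ, -, fv, hfv, hfv0, heig⟩ := hsat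
  refine ⟨ϖ, hϖ, fun i hi => ?_⟩
  -- the common level `𝔪 = 𝔫₀ 𝔫`
  set 𝔪 : Ideal (𝓞 K) := 𝔫₀ * 𝔫 with h𝔪
  have h𝔪0 : 𝔪 ≠ 0 := mul_ne_zero h𝔫₀ h𝔫
  have hv𝔪 : ¬ v.asIdeal ∣ 𝔪 := fun h => (v.prime.dvd_or_dvd h).elim hv hv𝔫
  have hle₀ : principalCongruenceLevel n K 𝔪 ≤ principalCongruenceLevel n K 𝔫₀ :=
    principalCongruenceLevel_mono n K h𝔪0 Ideal.mul_le_right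
  have hle₁ : principalCongruenceLevel n K 𝔪 ≤ principalCongruenceLevel n K 𝔫 :=
    principalCongruenceLevel_mono n K h𝔪0 Ideal.mul_le_left
  have hmax : IsMaximalAt n K v (principalCongruenceLevel n K 𝔪) :=
    isMaximalAt_principalCongruenceLevel n K v h𝔪0 hv𝔪
  -- the Hecke element as a local element
  set g : GL (Fin n) (v.adicCompletion K) :=
    glDiagonal n (v.adicCompletion K) fun k => if (k : ℕ) < i then ϖ else 1 with hg
  have ht : heckeDiagAt n K v ϖ i = GLn.ofLocal n K v g := heckeDiagAt_eq_ofLocal_glDiagonal ϖ i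
  -- Flath's scalar at level `𝔪`
  obtain ⟨c, hc⟩ := Flath1979_heckeOperatorAt_ofLocal_eq_smul_holds P h𝔪0 hv𝔪 g
  have hF𝔪 : F ∈ P.1.fixedVectors (principalCongruenceLevel n K 𝔪) :=
    P.1.fixedVectors_antitone hle₀ hF
  have hfv𝔪 : fv ∈ P.1.fixedVectors (principalCongruenceLevel n K 𝔪) :=
    P.1.fixedVectors_antitone hle₁ hfv
  -- identify `c` on the eigenvector `fv`
  have h1 : heckeOperatorAt P.1 (principalCongruenceLevel n K 𝔪) (GLn.ofLocal n K v g) fv =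
      heckeOperatorAt P.1 (principalCongruenceLevel n K 𝔫) (GLn.ofLocal n K v g) fv :=
    heckeOperatorAt_ofLocal_apply_eq_of_le P.1 hle₁ hmax (principalCongruenceLevel_le n K 𝔫) g hfv
  have hc' : c = (((Real.sqrt (v.residueCard : ℝ) : ℝ) : ℂ) ^ (i * (n - i)) * (α v).esymm i) := by
    have h2 := hc fv hfv𝔪
    rw [h1, ← ht, heig i hi] at h2
    exact (smul_left_injective ℂ hfv0 h2).symm
  -- transfer to `F` at level `𝔫₀`
  have h3 : heckeOperatorAt P.1 (principalCongruenceLevel n K 𝔪) (GLn.ofLocal n K v g) F =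
      heckeOperatorAt P.1 (principalCongruenceLevel n K 𝔫₀) (GLn.ofLocal n K v g) F :=
    heckeOperatorAt_ofLocal_apply_eq_of_le P.1 hle₀ hmax (principalCongruenceLevel_le n K 𝔫₀) g hF
  rw [ht, ← h3, hc F hF𝔪, hc']

/-- Translating an a.e. equality by the (measure-preserving) action. [folklore] -/
theorem ae_eq_comp_smul {f g : (AdelicGroupData.gl n K).automorphicQuotient → ℂ} (h : f =ᵐ[μ] g)
    (y : (AdelicGroupData.gl n K).Adelic) :
    (fun x => f (y • x)) =ᵐ[μ] fun x => g (y • x) :=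
  (measurePreserving_smul y μ).quasiMeasurePreserving.ae_eq_comp h

variable (W : ContRepresentation.ClosedSubrep ((AdelicGroupData.gl n K).rightRegular μ))

/-- **Hecke operators act pointwise on smoothed forms.** If the smoothed vector is `Kf`-fixed and an
eigenvector of the double-coset operator `[Kf t Kf]` with eigenvalue `c`, then for every transversal
`s` of `Kf t Kf / Kf` the *continuous* smoothed form satisfies
`Σ_{y ∈ s} S_η f (y⁻¹ • x) = c S_η f (x)`
at **every** point `x` (a.e. by `heckeOperator_apply_eq_sum` and `rightRegular_apply_coeFn`, then
everywhere by continuity and positivity of `μ` on open sets). [folklore] -/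
theorem sum_smoothedForm_inv_smul_eq {η : (AdelicGroupData.gl n K).Adelic → ℝ} (hη : Continuous η)
    (hηs : HasCompactSupport η) (f : W.toSubmodule) {Kf : Subgroup (AdelicGroupData.gl n K).Adelic}
    (t : (AdelicGroupData.gl n K).Adelic) (s : Finset (AdelicGroupData.gl n K).Adelic)
    (hs : Set.BijOn (fun x : (AdelicGroupData.gl n K).Adelic =>
      (x : (AdelicGroupData.gl n K).Adelic ⧸ Kf)) s (MulAction.orbit Kf (t : _ ⧸ Kf)))
    (hsv : smoothedVector W η f ∈ W.fixedVectors Kf) {c : ℂ}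
    (heig : heckeOperatorAt W Kf t (smoothedVector W η f) = c • smoothedVector W η f)
    (x : (AdelicGroupData.gl n K).automorphicQuotient) :
    ∑ y ∈ s, smoothedForm η (f : (AdelicGroupData.gl n K).L2 μ) (y⁻¹ • x) =
      c * smoothedForm η (f : (AdelicGroupData.gl n K).L2 μ) x := by
  set φ := smoothedForm η (f : (AdelicGroupData.gl n K).L2 μ) with hφ
  set sv := smoothedVector W η f with hsv'
  have hφc : Continuous φ := continuous_smoothedForm hη hηs _
  -- the operator identity in `W`, then in `L²`
  have hop : heckeOperatorAt W Kf t sv = ∑ y ∈ s, W.toContRep y sv :=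
    heckeOperator_apply_eq_sum W.toContRep.toRepresentation Kf t s hs hsv
  have hL2 : ((c • sv : W.toSubmodule) : (AdelicGroupData.gl n K).L2 μ) =
      ∑ y ∈ s, (AdelicGroupData.gl n K).rightRegular μ y (sv : (AdelicGroupData.gl n K).L2 μ) := by
    rw [← heig, hop, Submodule.coe_sum]
    rfl
  -- a.e. pointwise versions of both sides
  have hsvφ : ((sv : (AdelicGroupData.gl n K).L2 μ) :
      (AdelicGroupData.gl n K).automorphicQuotient → ℂ) =ᵐ[μ] φ := smoothedVector_ae_eq W hη hηs f
  have hright : ∀ s' : Finset (AdelicGroupData.gl n K).Adelic,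
      ((∑ y ∈ s', (AdelicGroupData.gl n K).rightRegular μ y (sv : (AdelicGroupData.gl n K).L2 μ) :
        (AdelicGroupData.gl n K).L2 μ) : (AdelicGroupData.gl n K).automorphicQuotient → ℂ) =ᵐ[μ]
        fun x => ∑ y ∈ s', φ (y⁻¹ • x) := by
    classical
    intro s'
    induction s' using Finset.induction_on with
    | empty =>
      simp only [Finset.sum_empty]
      exact Lp.coeFn_zero _ _ _
    | insert y s' hy ih =>
      rw [Finset.sum_insert hy]
      filter_upwards [Lp.coeFn_add ((AdelicGroupData.gl n K).rightRegular μ y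
          (sv : (AdelicGroupData.gl n K).L2 μ)) (∑ y ∈ s', (AdelicGroupData.gl n K).rightRegular μ y
          (sv : (AdelicGroupData.gl n K).L2 μ)), ih,
        AdelicGroupData.rightRegular_apply_coeFn (AdelicGroupData.gl n K) μ y
          (sv : (AdelicGroupData.gl n K).L2 μ), ae_eq_comp_smul hsvφ y⁻¹] with z h1 h2 h3 h4
      rw [h1, Pi.add_apply, h2, h3, h4, Finset.sum_insert hy]
  have hleft : (((c • sv : W.toSubmodule) : (AdelicGroupData.gl n K).L2 μ) :
      (AdelicGroupData.gl n K).automorphicQuotient → ℂ) =ᵐ[μ] fun x => c * φ x := by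
    rw [Submodule.coe_smul]
    filter_upwards [Lp.coeFn_smul c (sv : (AdelicGroupData.gl n K).L2 μ), hsvφ] with z h1 h2
    rw [h1, Pi.smul_apply, h2, smul_eq_mul]
  have hae : (fun x => ∑ y ∈ s, φ (y⁻¹ • x)) =ᵐ[μ] fun x => c * φ x := by
    rw [hL2] at hleft
    exact (hright s).symm.trans hleft
  -- continuity upgrades a.e. to everywhere
  have hc1 : Continuous fun x => ∑ y ∈ s, φ (y⁻¹ • x) :=
    continuous_finsetSum _ fun y _ => hφc.comp (continuous_const_smul y⁻¹)
  have hc2 : Continuous fun x => c * φ x := continuous_const.mul hφc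
  exact congrFun ((hc1.ae_eq_iff_eq μ hc2).1 hae) x

end Hecke

end Literature.NumberTheory.Automorphic
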